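import Mathlib.Algebra.MonoidAlgebra.MapDomain
import Mathlib.Algebra.MonoidAlgebra.Basic
import Mathlib.RingTheory.Ideal.Maps
import Mathlib.Algebra.Group.Submonoid.Operations
import HarnessLib

/-!
# Monoid algebras: the retraction `k[P] → k[F]` onto the algebra of a face and its kernel

Support file for crux stmt-ResolutionOfSingularities-15317 (`FrobeniusLadder.FRationalResolution`), line `redirect`,
brick L5 (log regularity of toric algebras). For a submonoid `P` of a commutative monoid `G` and a FACE `F ≤ P`
(`a + b ∈ F ⇒ a ∈ F` for `a, b ∈ P`), the complement `P ∖ F` is a prime ideal of `P`, so `χ(p) = x^p` for `p ∈ F`,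
`χ(p) = 0` for `p ∉ F` is multiplicative and induces a `k`-algebra RETRACTION `π : k[P] → k[F]` of the inclusion
`k[F] ⊆ k[P]` whose kernel is the monomial ideal spanned by `x^p`, `p ∈ P ∖ F`; hence `k[P]/(x^p : p ∉ F) ≅ k[F]`.
This is the computation `𝒪/I(x, M) = k[F]_𝔭` behind Kato's condition (2.1)(i) for the toric algebra `k[P]`.

* `exists_faceRetraction` — the retraction `π` with its values on monomials;
* `faceRetraction_comp_inclusion`, `faceRetraction_surjective` — `π ∘ (k[F] ⊆ k[P]) = id`;
* `faceRetraction_ker` — `ker π = (x^p : p ∈ P ∖ F)`.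

All folklore (e.g. Bruns–Herzog 6.1, CLS 2011 §1.2); no published fact is used.
-/

-- single-problem summit: the doubled namespace component is forced
set_option linter.dupNamespace false

noncomputable section

namespace Summit.ResolutionOfSingularities.ResolutionOfSingularities.Theorems.FRationalResolution

open AddMonoidAlgebra

universe u v

variable (k : Type u) [CommRing k] {G : Type v} [AddCommMonoid G] {P F : AddSubmonoid G}

/-- **The face retraction.** For a face `F` of `P` there is a `k`-algebra homomorphism `π : k[P] → k[F]` with
`π(x^p) = x^p` for `p ∈ F` and `π(x^p) = 0` for `p ∉ F` (the monoid homomorphism-with-zero `P → F ∪ {0}`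
killing the prime ideal `P ∖ F`, extended linearly). [folklore] -/
theorem exists_faceRetraction (hface : ∀ a ∈ P, ∀ b ∈ P, a + b ∈ F → a ∈ F) :
    ∃ π : AddMonoidAlgebra k ↥P →ₐ[k] AddMonoidAlgebra k ↥F,
      (∀ (p : ↥P) (hp : (p : G) ∈ F) (c : k),
          π (AddMonoidAlgebra.single p c) = AddMonoidAlgebra.single (⟨(p : G), hp⟩ : ↥F) c) ∧
      (∀ (p : ↥P), (p : G) ∉ F → ∀ c : k, π (AddMonoidAlgebra.single p c) = 0) := by
  classical
  have hface' : ∀ a ∈ P, ∀ b ∈ P, a + b ∈ F → b ∈ F := fun a ha b hb hab =>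
    hface b hb a ha (by rwa [add_comm])
  let χ : Multiplicative ↥P →* AddMonoidAlgebra k ↥F :=
    { toFun := fun p => if hp : ((Multiplicative.toAdd p : ↥P) : G) ∈ F then
          AddMonoidAlgebra.single (⟨_, hp⟩ : ↥F) 1 else 0
      map_one' := by
        have h0 : ((Multiplicative.toAdd (1 : Multiplicative ↥P) : ↥P) : G) ∈ F := by
          simp only [toAdd_one, ZeroMemClass.coe_zero]; exact F.zero_mem
        rw [dif_pos h0]
        have : (⟨_, h0⟩ : ↥F) = 0 := Subtype.ext (by simp)
        rw [this]; rfl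
      map_mul' := by
        intro a b
        have hab : ((Multiplicative.toAdd (a * b) : ↥P) : G) =
            ((Multiplicative.toAdd a : ↥P) : G) + ((Multiplicative.toAdd b : ↥P) : G) := by
          simp only [toAdd_mul, AddSubmonoid.coe_add]
        by_cases ha : ((Multiplicative.toAdd a : ↥P) : G) ∈ F
        · by_cases hb : ((Multiplicative.toAdd b : ↥P) : G) ∈ F
          · have hab' : ((Multiplicative.toAdd (a * b) : ↥P) : G) ∈ F := by rw [hab]; exact F.add_mem ha hb
            rw [dif_pos hab', dif_pos ha, dif_pos hb, AddMonoidAlgebra.single_mul_single, mul_one]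
            exact congrArg (AddMonoidAlgebra.single · (1 : k)) (Subtype.ext hab)
          · have hab' : ((Multiplicative.toAdd (a * b) : ↥P) : G) ∉ F := fun h =>
              hb (hface' _ (Multiplicative.toAdd a).2 _ (Multiplicative.toAdd b).2 (by rwa [hab] at h))
            rw [dif_neg hab', dif_neg hb, mul_zero]
        · have hab' : ((Multiplicative.toAdd (a * b) : ↥P) : G) ∉ F := fun h =>
            ha (hface _ (Multiplicative.toAdd a).2 _ (Multiplicative.toAdd b).2 (by rwa [hab] at h))
          rw [dif_neg hab', dif_neg ha, zero_mul] }
  have hχ : ∀ p : ↥P, χ (Multiplicative.ofAdd p) =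
      if hp : (p : G) ∈ F then AddMonoidAlgebra.single (⟨_, hp⟩ : ↥F) 1 else 0 := fun p => rfl
  refine ⟨AddMonoidAlgebra.lift k _ _ χ, fun p hp c => ?_, fun p hp c => ?_⟩
  · rw [AddMonoidAlgebra.lift_single, hχ, dif_pos hp, AddMonoidAlgebra.smul_single, smul_eq_mul, mul_one]
  · rw [AddMonoidAlgebra.lift_single, hχ, dif_neg hp, smul_zero]

variable {k}

/-- The face retraction is a retraction of the inclusion `k[F] ⊆ k[P]`. [folklore] -/
theorem faceRetraction_comp_inclusion (hFP : F ≤ P) (π : AddMonoidAlgebra k ↥P →ₐ[k] AddMonoidAlgebra k ↥F)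
    (hπ₁ : ∀ (p : ↥P) (hp : (p : G) ∈ F) (c : k),
      π (AddMonoidAlgebra.single p c) = AddMonoidAlgebra.single (⟨(p : G), hp⟩ : ↥F) c)
    (y : AddMonoidAlgebra k ↥F) :
    π (AddMonoidAlgebra.mapDomainAlgHom k k (AddSubmonoid.inclusion hFP) y) = y := by
  induction y using AddMonoidAlgebra.induction_linear with
  | zero => simp
  | add f g hf hg => rw [map_add, map_add, hf, hg]
  | single f c =>
    rw [AddMonoidAlgebra.mapDomainAlgHom_apply, AddMonoidAlgebra.mapDomain_single, hπ₁ _ (by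
      change ((AddSubmonoid.inclusion hFP f : ↥P) : G) ∈ F; exact f.2)]
    rfl

/-- The face retraction is surjective. [folklore] -/
theorem faceRetraction_surjective (hFP : F ≤ P) (π : AddMonoidAlgebra k ↥P →ₐ[k] AddMonoidAlgebra k ↥F)
    (hπ₁ : ∀ (p : ↥P) (hp : (p : G) ∈ F) (c : k),
      π (AddMonoidAlgebra.single p c) = AddMonoidAlgebra.single (⟨(p : G), hp⟩ : ↥F) c) :
    Function.Surjective π := fun y =>
  ⟨_, faceRetraction_comp_inclusion hFP π hπ₁ y⟩

/-- Every element of `k[P]` is congruent to (the image of) its retraction modulo the monomial ideal of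
`P ∖ F`. [folklore] -/
theorem sub_inclusion_faceRetraction_mem (hFP : F ≤ P) (π : AddMonoidAlgebra k ↥P →ₐ[k] AddMonoidAlgebra k ↥F)
    (hπ₁ : ∀ (p : ↥P) (hp : (p : G) ∈ F) (c : k),
      π (AddMonoidAlgebra.single p c) = AddMonoidAlgebra.single (⟨(p : G), hp⟩ : ↥F) c)
    (hπ₂ : ∀ (p : ↥P), (p : G) ∉ F → ∀ c : k, π (AddMonoidAlgebra.single p c) = 0)
    (x : AddMonoidAlgebra k ↥P) :
    x - AddMonoidAlgebra.mapDomainAlgHom k k (AddSubmonoid.inclusion hFP) (π x) ∈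
      Ideal.span ((fun p : ↥P => AddMonoidAlgebra.single p (1 : k)) '' {p : ↥P | (p : G) ∉ F}) := by
  induction x using AddMonoidAlgebra.induction_linear with
  | zero => simp
  | add f g hf hg =>
    have : f + g - AddMonoidAlgebra.mapDomainAlgHom k k (AddSubmonoid.inclusion hFP) (π (f + g)) =
        (f - AddMonoidAlgebra.mapDomainAlgHom k k (AddSubmonoid.inclusion hFP) (π f)) +
          (g - AddMonoidAlgebra.mapDomainAlgHom k k (AddSubmonoid.inclusion hFP) (π g)) := by
      rw [map_add, map_add]; abel
    rw [this]
    exact Ideal.add_mem _ hf hg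
  | single p c =>
    by_cases hp : (p : G) ∈ F
    · rw [hπ₁ p hp, AddMonoidAlgebra.mapDomainAlgHom_apply, AddMonoidAlgebra.mapDomain_single]
      have : AddSubmonoid.inclusion hFP ⟨(p : G), hp⟩ = p := Subtype.ext rfl
      rw [this, sub_self]
      exact Ideal.zero_mem _
    · rw [hπ₂ p hp, map_zero, sub_zero]
      have : AddMonoidAlgebra.single p c = c • AddMonoidAlgebra.single p (1 : k) := by
        rw [AddMonoidAlgebra.smul_single, smul_eq_mul, mul_one]
      rw [this, Algebra.smul_def]
      exact Ideal.mul_mem_left _ _ (Ideal.subset_span ⟨p, hp, rfl⟩)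

/-- **The kernel of the face retraction is the monomial ideal of `P ∖ F`.** [folklore] -/
theorem faceRetraction_ker (hFP : F ≤ P) (π : AddMonoidAlgebra k ↥P →ₐ[k] AddMonoidAlgebra k ↥F)
    (hπ₁ : ∀ (p : ↥P) (hp : (p : G) ∈ F) (c : k),
      π (AddMonoidAlgebra.single p c) = AddMonoidAlgebra.single (⟨(p : G), hp⟩ : ↥F) c)
    (hπ₂ : ∀ (p : ↥P), (p : G) ∉ F → ∀ c : k, π (AddMonoidAlgebra.single p c) = 0) :
    RingHom.ker π = Ideal.span ((fun p : ↥P => AddMonoidAlgebra.single p (1 : k)) '' {p : ↥P | (p : G) ∉ F}) := by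
  apply le_antisymm
  · intro x hx
    rw [RingHom.mem_ker] at hx
    have h := sub_inclusion_faceRetraction_mem hFP π hπ₁ hπ₂ x
    rwa [show (π x : AddMonoidAlgebra k ↥F) = 0 from hx, map_zero, sub_zero] at h
  · refine Ideal.span_le.2 ?_
    rintro _ ⟨p, hp, rfl⟩
    change π (AddMonoidAlgebra.single p 1) = 0
    exact hπ₂ p hp 1

end Summit.ResolutionOfSingularities.ResolutionOfSingularities.Theorems.FRationalResolution

end
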